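import Summits.QuantumFields.QCD.Theses.SpectralDefectExtinction
import Literature.MathematicalPhysics.QuantumLattice.OverlapLocality
import Literature.MathematicalPhysics.QuantumLattice.FinDimSpectrumClusterGapProofs
import Literature.MathematicalPhysics.QuantumFieldTheory.SpectralDefectDensity
import Summits.QuantumFields.QCD.Theorems.TipPricing.Negative.TightPins
import Summits.QuantumFields.QCD.Theorems.SpectralDefectExtinctionTipNoBindingStubPositivity
import Summits.QuantumFields.QCD.Theorems.ExtinctionBuildsQCD.Negative.ChiralInertia
import Summits.QuantumFields.QCD.Theorems.SpectralDefectExtinctionTipPricingStubKyFanCountAux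

/-!
# Stub `stub_kyFanCount` of line `covariant-laplacian-floor` (deep part of the heavy-side DOS bound of line `hermitian-flow-coarea`)
(crux `Summit.QuantumFields.QCD.Theses.SpectralDefectExtinction.TipPricing`, item stmt-QuantumFields-8967)

**What is proved.**  For every `SU(3)` link field `U` on the four-torus `(ℤ/L)⁴`, every real `t`
and every `θ ∈ (0,1)`:

  `(1 − θ) · #{roots z of χ_D (with multiplicity) : Re z < t} ≤ 4 · #{eigenvalues λ of Lap_U : λ < 2t/θ}`,

where `D = D_W(U,0,1) = wilsonDirac (fundamentalRep (Fin 3)) U 0 1` is the massless `r = 1`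
Wilson–Dirac matrix (NOT normal) on site × colour × spin and
`Lap_U = Σ_μ (2 − F_μ − F_μᴴ)` is the positive covariant Laplacian on site × colour
(`F_μ = linkHop`, the unitary `U`-twisted forward shift).  Small real parts of the non-normal `D`
are paid for by low levels of the Hermitian `Lap_U`, because `Re D = ½ Lap_U ⊗ 1_spin ⪰ 0`.

**Proof (Ky Fan / trace count, no Schur flag).**  Work on `E = EuclideanSpace ℂ (site × colour × spin)`
with `f = toEuclideanLin D`.
* `V := ⨆_{Re z < t} maxGenEigenspace f z` is `f`-invariant and the characteristic polynomial of
  `f|_V` has as roots exactly the roots of `χ_D` with `Re z < t` (Aux file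
  `SpectralDefectExtinctionTipPricingStubKyFanCountAux.lean`, registered sub-goal
  `stub_kyFanTraceCount`: generalized eigenspaces of a restriction, `Submodule.inf_genEigenspace`,
  `dim maxGenEigenspace = algebraic multiplicity`, independence of generalized eigenspaces).  Hence
  `dim V = k` (the left count) and `tr f|_V = Σ_{Re z < t} z`, so `Re tr f|_V < k t` if `k ≥ 1`.
* Wilson positivity (landed stub `stub_positivity`) and the same completion of squares for `Lap_U`
  (`kyFan_re_form_laplacian`) give `2 Re⟨ψ, Dψ⟩ = Σ_α ⟨ψ_α, Lap_U ψ_α⟩` spin component by spin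
  component (`kyFan_two_re_form_wilsonDirac`); expanding each `ψ_α` in an eigenbasis of `Lap_U`,
  the subspace `W = {ψ : ψ_α ⊥ every eigenvector of level < a, all α}` (`a = 2t/θ`) has
  `dim W ≥ 12L⁴ − 4M` (rank–nullity) and `Re⟨ψ, Dψ⟩ ≥ (a/2)‖ψ‖²` on it (`kyFan_floor_subspace`),
  while `Re⟨ψ, Dψ⟩ ≥ 0` everywhere.
* In an orthonormal basis of `V` adapted to `V ∩ W ⊕ (V ∩ W)^⊥` the real part of the trace is the
  sum of `Re⟨e_i, D e_i⟩ ≥ (a/2)·[e_i ∈ V ∩ W]` (trace floor of the Aux file, Mathlib's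
  `LinearMap.trace_eq_sum_inner` and `DirectSum.IsInternal.collectedOrthonormalBasis`), and
  `dim (V ∩ W) ≥ k − 4M`.  So `(t/θ)(k − 4M) ≤ Re tr f|_V < k t`, i.e. `(1 − θ)k < 4M`
  (and `k = 0` is trivial; `t ≤ 0 < k` is impossible since the trace is `≥ 0`).
Positive semidefiniteness of `Re D` is genuinely used.  Sources: Ky Fan (1950) /
Bhatia, *Matrix Analysis* (1997) Prop. III.5.3 for the principle `Re λ(A) ≺ λ(Re A)`; everything
leaned on is proved in the tree (`stub_positivity`, `OverlapLocality.lean`,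
`FinDimSpectrumClusterGapProofs.lean`, `ChiralInertia.lean`, the Aux file) or in Mathlib.  No named
facts.
-/

namespace Summit.QuantumFields.QCD.Cruxes.TipPricing.CovariantLaplacianFloor

open MeasureTheory Filter Matrix
open Literature.MathematicalPhysics.QuantumLattice Literature.MathematicalPhysics.QuantumFieldTheory
  Literature.Probability.LatticeModels
open Summit.QuantumFields.QCD.Theses.SpectralDefectExtinction
open scoped Classical

noncomputable section

open scoped InnerProductSpace

/-! ## Matrix forms: the covariant Laplacian and twice the Hermitian part of `D_W` -/

section Forms

variable {P : Type*} [Fintype P]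

/-- `Re⟨v, v⟩ = Σ_i ‖v i‖²`. -/
-- adapted from Theorems/SpectralDefectExtinctionTipNoBindingStubPositivity.lean
private theorem kyFan_re_star_dotProduct_self (v : P → ℂ) :
    (star v ⬝ᵥ v).re = ∑ i, ‖v i‖ ^ 2 := by
  rw [dotProduct, Complex.re_sum]
  refine Finset.sum_congr rfl fun i _ => ?_
  rw [Pi.star_apply, Complex.star_def, ← Complex.normSq_eq_conj_mul_self, Complex.ofReal_re,
    Complex.normSq_eq_norm_sq]

/-- `Re⟨v, Aᴴ v⟩ = Re⟨v, A v⟩`. -/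
-- adapted from Theorems/SpectralDefectExtinctionTipNoBindingStubPositivity.lean
private theorem kyFan_re_conjTranspose_mulVec (A : Matrix P P ℂ) (v : P → ℂ) :
    (star v ⬝ᵥ Aᴴ *ᵥ v).re = (star v ⬝ᵥ A *ᵥ v).re := by
  rw [mulVec_conjTranspose, star_dotProduct_star, ← dotProduct_mulVec, Complex.star_def,
    Complex.conj_re]

/-- For an isometry `A` (`AᴴA = 1`): `Σ‖(A v − v) i‖² = 2 Σ‖v i‖² − 2 Re⟨v, A v⟩`. -/
-- adapted from Theorems/SpectralDefectExtinctionTipNoBindingStubPositivity.lean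
private theorem kyFan_sum_norm_sq_mulVec_sub_self [DecidableEq P] (A : Matrix P P ℂ)
    (hA : Aᴴ * A = 1) (v : P → ℂ) :
    ∑ i, ‖(A *ᵥ v - v) i‖ ^ 2 = 2 * ∑ i, ‖v i‖ ^ 2 - 2 * (star v ⬝ᵥ A *ᵥ v).re := by
  rw [← kyFan_re_star_dotProduct_self, ← kyFan_re_star_dotProduct_self, star_sub,
    sub_dotProduct, dotProduct_sub, dotProduct_sub, star_mulVec, ← dotProduct_mulVec, mulVec_mulVec,
    hA, one_mulVec, Complex.sub_re, Complex.sub_re, Complex.sub_re]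
  have : (star v ᵥ* Aᴴ ⬝ᵥ v).re = (star v ⬝ᵥ A *ᵥ v).re := by
    rw [← star_mulVec, star_dotProduct, Complex.star_def, Complex.conj_re]
  rw [this]
  ring

omit [Fintype P] in
/-- The matrix `Σ_μ (2 − F_μ − F_μᴴ)` is Hermitian. -/
theorem kyFan_isHermitian_laplacian [DecidableEq P] {ι : Type*} [Fintype ι] (F : ι → Matrix P P ℂ) :
    (∑ μ, ((2 : ℂ) • (1 : Matrix P P ℂ) - F μ - (F μ)ᴴ)).IsHermitian := by
  unfold Matrix.IsHermitian
  rw [conjTranspose_sum]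
  refine Finset.sum_congr rfl fun μ _ => ?_
  have h2 : ((2 : ℂ) • (1 : Matrix P P ℂ))ᴴ = (2 : ℂ) • (1 : Matrix P P ℂ) := by
    rw [conjTranspose_smul, conjTranspose_one, star_ofNat]
  rw [conjTranspose_sub, conjTranspose_sub, h2, conjTranspose_conjTranspose, sub_right_comm]

/-- **The covariant-Laplacian form** for a family of isometries `F_μ`:
`Re⟨v, Σ_μ (2 − F_μ − F_μᴴ) v⟩ = Σ_μ Σ_i ‖(F_μ v − v) i‖²`. -/
theorem kyFan_re_form_laplacian [DecidableEq P] {ι : Type*} [Fintype ι] (F : ι → Matrix P P ℂ)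
    (hF : ∀ μ, (F μ)ᴴ * F μ = 1) (v : P → ℂ) :
    (star v ⬝ᵥ (∑ μ, ((2 : ℂ) • (1 : Matrix P P ℂ) - F μ - (F μ)ᴴ)) *ᵥ v).re =
      ∑ μ, ∑ i, ‖(F μ *ᵥ v - v) i‖ ^ 2 := by
  rw [sum_mulVec, dotProduct_sum, Complex.re_sum]
  refine Finset.sum_congr rfl fun μ _ => ?_
  rw [sub_mulVec, sub_mulVec, smul_mulVec, one_mulVec, dotProduct_sub, dotProduct_sub,
    dotProduct_smul, Complex.sub_re, Complex.sub_re, kyFan_re_conjTranspose_mulVec,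
    kyFan_sum_norm_sq_mulVec_sub_self (F μ) (hF μ), smul_eq_mul, Complex.mul_re, Complex.re_ofNat,
    Complex.im_ofNat, zero_mul, sub_zero, kyFan_re_star_dotProduct_self]
  ring

/-- A fourfold sum rearrangement. -/
private theorem kyFan_sum_comm₄ {A B C G : Type*} [Fintype A] [Fintype B] [Fintype C] [Fintype G]
    (T : A → B → C → G → ℝ) :
    ∑ x, ∑ μ, ∑ a, ∑ α, T x μ a α = ∑ α, ∑ μ, ∑ x, ∑ a, T x μ a α := by
  calc ∑ x, ∑ μ, ∑ a, ∑ α, T x μ a α = ∑ x, ∑ μ, ∑ α, ∑ a, T x μ a α :=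
        Finset.sum_congr rfl fun x _ => Finset.sum_congr rfl fun μ _ => Finset.sum_comm
    _ = ∑ x, ∑ α, ∑ μ, ∑ a, T x μ a α := Finset.sum_congr rfl fun x _ => Finset.sum_comm
    _ = ∑ α, ∑ x, ∑ μ, ∑ a, T x μ a α := Finset.sum_comm
    _ = ∑ α, ∑ μ, ∑ x, ∑ a, T x μ a α := Finset.sum_congr rfl fun α _ => Finset.sum_comm

/-- A threefold sum rearrangement. -/
private theorem kyFan_sum_comm₃ {A B C : Type*} [Fintype A] [Fintype B] [Fintype C]
    (T : A → B → C → ℝ) :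
    ∑ y, ∑ b, ∑ α, T y b α = ∑ α, ∑ y, ∑ b, T y b α :=
  (Finset.sum_congr rfl fun _ _ => Finset.sum_comm).trans Finset.sum_comm

variable {L : ℕ} [NeZero L]

/-- Entrywise action of the twisted shift: `(F_μ w)(x,a) = Σ_b U(x,μ)_{ab} w(x+μ̂, b)`. -/
theorem kyFan_linkHop_mulVec (U : GaugeConfig 4 L SU3) (μ : Fin 4)
    (w : TorusSite 4 L × Fin 3 → ℂ) (x : TorusSite 4 L) (a : Fin 3) :
    (linkHop (fundamentalRep (Fin 3)) U μ *ᵥ w) (x, a) =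
      ∑ b, (U (x, μ) : Matrix (Fin 3) (Fin 3) ℂ) a b * w (Site.shift x μ, b) := by
  rw [mulVec, dotProduct, Fintype.sum_prod_type,
    Finset.sum_eq_single_of_mem (Site.shift x μ) (Finset.mem_univ _)]
  · refine Finset.sum_congr rfl fun b _ => ?_
    simp [linkHop]
  · intro y _ hy
    simp [linkHop, hy]

/-- **Twice the Hermitian part of `D_W(U,0,1)` is the covariant Laplacian, spin component by spin
component**: `2 Re⟨ψ, Dψ⟩ = Σ_α Re⟨ψ_α, Lap_U ψ_α⟩` with `ψ_α(x,a) = ψ(x,a,α)` (Wilson positivity,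
`stub_positivity`, against the completed square `kyFan_re_form_laplacian`). -/
theorem kyFan_two_re_form_wilsonDirac (U : GaugeConfig 4 L SU3) (ψ : QuarkIdx L → ℂ) :
    2 * (star ψ ⬝ᵥ wilsonDirac (fundamentalRep (Fin 3)) U 0 1 *ᵥ ψ).re =
      ∑ α : Fin 4, (star (fun p : TorusSite 4 L × Fin 3 => ψ (p.1, p.2, α)) ⬝ᵥ
        (∑ μ : Fin 4, ((2 : ℂ) • (1 : Matrix (TorusSite 4 L × Fin 3) (TorusSite 4 L × Fin 3) ℂ)
          - linkHop (fundamentalRep (Fin 3)) U μ - (linkHop (fundamentalRep (Fin 3)) U μ)ᴴ)) *ᵥ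
          (fun p : TorusSite 4 L × Fin 3 => ψ (p.1, p.2, α))).re := by
  have hρ : ∀ g, fundamentalRep (Fin 3) g ∈ Matrix.unitaryGroup (Fin 3) ℂ :=
    fundamentalRep_mem_unitaryGroup
  have hR : ∀ α : Fin 4, (star (fun p : TorusSite 4 L × Fin 3 => ψ (p.1, p.2, α)) ⬝ᵥ
      (∑ μ : Fin 4, ((2 : ℂ) • (1 : Matrix (TorusSite 4 L × Fin 3) (TorusSite 4 L × Fin 3) ℂ)
        - linkHop (fundamentalRep (Fin 3)) U μ - (linkHop (fundamentalRep (Fin 3)) U μ)ᴴ)) *ᵥ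
        (fun p : TorusSite 4 L × Fin 3 => ψ (p.1, p.2, α))).re =
      ∑ μ, ∑ x, ∑ a, ‖(∑ b, (U (x, μ) : Matrix (Fin 3) (Fin 3) ℂ) a b *
        ψ (Site.shift x μ, b, α)) - ψ (x, a, α)‖ ^ 2 := by
    intro α
    rw [kyFan_re_form_laplacian _ (fun μ => conjTranspose_mul_linkHop _ hρ U μ)]
    refine Finset.sum_congr rfl fun μ _ => ?_
    rw [Fintype.sum_prod_type]
    refine Finset.sum_congr rfl fun x _ => Finset.sum_congr rfl fun a _ => ?_
    rw [Pi.sub_apply, kyFan_linkHop_mulVec]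
  simp only [hR]
  rw [TipNoBinding.PositivityNoLeakSpread.stub_positivity L U ψ, ← mul_assoc,
    mul_one_div_cancel (two_ne_zero' ℝ), one_mul]
  exact kyFan_sum_comm₄ _

end Forms

/-! ## The floor subspace and the count -/

section Floor

variable {L : ℕ} [NeZero L]

/-- `Re⟪x, toEuclideanLin A x⟫ = Re(x† A x)`. -/
theorem kyFan_re_inner_toEuclideanLin {n : Type*} [Fintype n] [DecidableEq n] (A : Matrix n n ℂ)
    (x : EuclideanSpace ℂ n) :
    (⟪x, toEuclideanLin A x⟫_ℂ).re = (star (WithLp.ofLp x) ⬝ᵥ A *ᵥ WithLp.ofLp x).re := by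
  rw [EuclideanSpace.inner_eq_star_dotProduct, Matrix.ofLp_toLpLin, Matrix.toLin'_apply,
    dotProduct_comm]

/-- **The floor subspace.**  With `Lap_U` Hermitian, eigenvalues `λ_i`, and `a` real: the subspace
`W = {ψ : every spin component ψ_α is orthogonal to the eigenvectors with λ_i < a}` of
`EuclideanSpace ℂ (site × colour × spin)` has `dim W + 4·#{i | λ_i < a} ≥ 12L⁴` and
`Re⟪ψ, Dψ⟫ ≥ (a/2)‖ψ‖²` on `W`. -/
theorem kyFan_floor_subspace (U : GaugeConfig 4 L SU3) (a : ℝ)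
    (hH : (∑ μ : Fin 4, ((2 : ℂ) • (1 : Matrix (TorusSite 4 L × Fin 3) (TorusSite 4 L × Fin 3) ℂ)
      - linkHop (fundamentalRep (Fin 3)) U μ - (linkHop (fundamentalRep (Fin 3)) U μ)ᴴ)).IsHermitian) :
    ∃ W : Submodule ℂ (EuclideanSpace ℂ (QuarkIdx L)),
      Fintype.card (QuarkIdx L) ≤ Module.finrank ℂ W +
        4 * (Finset.univ.filter fun i => hH.eigenvalues i < a).card ∧
      ∀ x ∈ W, a / 2 * ‖x‖ ^ 2 ≤
        (⟪x, toEuclideanLin (wilsonDirac (fundamentalRep (Fin 3)) U 0 1) x⟫_ℂ).re := by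
  -- spin components
  let π : Fin 4 → EuclideanSpace ℂ (QuarkIdx L) →ₗ[ℂ] EuclideanSpace ℂ (TorusSite 4 L × Fin 3) :=
    fun α =>
      { toFun := fun ψ => WithLp.toLp 2 (fun p : TorusSite 4 L × Fin 3 => ψ (p.1, p.2, α))
        map_add' := fun _ _ => rfl
        map_smul' := fun _ _ => rfl }
  let Φ : EuclideanSpace ℂ (QuarkIdx L) →ₗ[ℂ]
      (Fin 4 × {i : TorusSite 4 L × Fin 3 // hH.eigenvalues i < a} → ℂ) :=
    LinearMap.pi fun q : Fin 4 × {i : TorusSite 4 L × Fin 3 // hH.eigenvalues i < a} =>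
      (innerₛₗ ℂ (hH.eigenvectorBasis q.2.1) :
        EuclideanSpace ℂ (TorusSite 4 L × Fin 3) →ₗ[ℂ] ℂ) ∘ₗ π q.1
  refine ⟨LinearMap.ker Φ, ?_, ?_⟩
  · have h1 := Φ.finrank_range_add_finrank_ker
    have h2 : Module.finrank ℂ (LinearMap.range Φ) ≤
        4 * (Finset.univ.filter fun i => hH.eigenvalues i < a).card := by
      refine (Submodule.finrank_le _).trans (le_of_eq ?_)
      rw [Module.finrank_pi ℂ, Fintype.card_prod, Fintype.card_fin, Fintype.card_subtype]
    rw [finrank_euclideanSpace] at h1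
    omega
  · intro x hx
    have hzero : ∀ (α : Fin 4) (j : TorusSite 4 L × Fin 3), hH.eigenvalues j < a →
        ⟪hH.eigenvectorBasis j, π α x⟫_ℂ = 0 := fun α j hj => by
      have := congrFun (LinearMap.mem_ker.mp hx) (α, ⟨j, hj⟩)
      simpa [Φ, LinearMap.pi_apply] using this
    -- floor on each spin component
    have hα : ∀ α, a * ‖π α x‖ ^ 2 ≤ RCLike.re ⟪π α x, toEuclideanLin (∑ μ : Fin 4,
        ((2 : ℂ) • (1 : Matrix (TorusSite 4 L × Fin 3) (TorusSite 4 L × Fin 3) ℂ)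
          - linkHop (fundamentalRep (Fin 3)) U μ - (linkHop (fundamentalRep (Fin 3)) U μ)ᴴ))
          (π α x)⟫_ℂ := fun α => by
      rw [re_inner_toEuclideanLin_eq_sum hH, norm_sq_eq_sum_eigenvectorBasis hH (π α x),
        Finset.mul_sum]
      refine Finset.sum_le_sum fun i _ => ?_
      by_cases hi : hH.eigenvalues i < a
      · rw [hzero α i hi, norm_zero]; simp
      · exact mul_le_mul_of_nonneg_right (not_lt.mp hi) (sq_nonneg _)
    -- the identity `2 Re⟪x, Dx⟫ = Σ_α Re⟪x_α, Lap x_α⟫`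
    have hid : 2 * (⟪x, toEuclideanLin (wilsonDirac (fundamentalRep (Fin 3)) U 0 1) x⟫_ℂ).re =
        ∑ α, RCLike.re ⟪π α x, toEuclideanLin (∑ μ : Fin 4,
          ((2 : ℂ) • (1 : Matrix (TorusSite 4 L × Fin 3) (TorusSite 4 L × Fin 3) ℂ)
            - linkHop (fundamentalRep (Fin 3)) U μ - (linkHop (fundamentalRep (Fin 3)) U μ)ᴴ))
            (π α x)⟫_ℂ := by
      rw [kyFan_re_inner_toEuclideanLin, kyFan_two_re_form_wilsonDirac]
      exact Finset.sum_congr rfl fun α _ => (kyFan_re_inner_toEuclideanLin _ (π α x)).symm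
    -- `‖x‖² = Σ_α ‖x_α‖²`
    have hnorm : ‖x‖ ^ 2 = ∑ α, ‖π α x‖ ^ 2 := by
      have hR : ∀ α, ‖π α x‖ ^ 2 = ∑ y : TorusSite 4 L, ∑ b : Fin 3, ‖x (y, b, α)‖ ^ 2 :=
        fun α => by
        rw [← Fintype.sum_prod_type']
        exact EuclideanSpace.norm_sq_eq (π α x)
      simp only [hR]
      rw [EuclideanSpace.norm_sq_eq, Fintype.sum_prod_type]
      simp only [Fintype.sum_prod_type]
      exact kyFan_sum_comm₃ _
    calc a / 2 * ‖x‖ ^ 2 = 1 / 2 * ∑ α, a * ‖π α x‖ ^ 2 := by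
          rw [hnorm, ← Finset.mul_sum]; ring
      _ ≤ 1 / 2 * ∑ α, RCLike.re ⟪π α x, toEuclideanLin (∑ μ : Fin 4,
          ((2 : ℂ) • (1 : Matrix (TorusSite 4 L × Fin 3) (TorusSite 4 L × Fin 3) ℂ)
            - linkHop (fundamentalRep (Fin 3)) U μ - (linkHop (fundamentalRep (Fin 3)) U μ)ᴴ))
            (π α x)⟫_ℂ := by
          gcongr with α _
          exact hα α
      _ = _ := by rw [← hid]; ring

end Floor

/-- **Ky Fan count** (registered stub `stub_kyFanCount` of line `covariant-laplacian-floor`).  For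
every `SU(3)` field `U` on the torus `(ℤ/L)⁴`, every real `t` and every `θ ∈ (0,1)`:
`(1 − θ) · #{eigenvalues z of D_W(U,0,1) (alg. mult.) with Re z < t}
≤ 4 · #{eigenvalues of Lap_U below 2t/θ}`, `Lap_U = Σ_μ (2 − F_μ − F_μᴴ)` on site ⊗ colour.
Proof (no Schur flag): `V := ⊕_{Re z < t} maxGenEigenspace z` of `f = toEuclideanLin D_W` is
`f`-invariant with `dim V = k :=` the left count and `tr(f|_V) = Σ_{Re z<t} z`, so `Re tr(f|_V) < kt`
for `k ≥ 1` (sub-goal `stub_kyFanTraceCount`, Aux file); by Wilson positivity (`stub_positivity`)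
`2 Re⟨ψ, Dψ⟩ = Σ_α ⟨ψ_α, Lap_U ψ_α⟩ ≥ 0`, and on the subspace `W` of spinors whose spin components
are orthogonal to the Laplacian eigenvectors of level `< 2t/θ` (`dim W ≥ 12L⁴ − 4M`) it is
`≥ (2t/θ)‖ψ‖²` (`kyFan_floor_subspace`); in an orthonormal basis of `V` adapted to `V ∩ W` this gives
`(t/θ)·dim(V ∩ W) ≤ Re tr(f|_V) < kt` with `dim(V ∩ W) ≥ k − 4M`, i.e. `(1 − θ)k < 4M`
(`k = 0` is trivial, and `t ≤ 0 < k` contradicts `Re tr ≥ 0`).  PSD of `Re D` is genuinely needed. -/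
theorem stub_kyFanCount :
    ∀ (L : ℕ) [NeZero L] (U : GaugeConfig 4 L SU3) (t θ : ℝ), 0 < θ → θ < 1 →
      (1 - θ) * (Multiset.countP (fun z : ℂ => z.re < t)
          (wilsonDirac (fundamentalRep (Fin 3)) U 0 1).charpoly.roots : ℝ)
        ≤ 4 * (Multiset.countP (fun z : ℂ => z.re < 2 * t / θ)
          (∑ μ : Fin 4, ((2 : ℂ) • (1 : Matrix (TorusSite 4 L × Fin 3) (TorusSite 4 L × Fin 3) ℂ)
            - linkHop (fundamentalRep (Fin 3)) U μ
            - (linkHop (fundamentalRep (Fin 3)) U μ)ᴴ)).charpoly.roots : ℝ) := by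
  intro L _ U t θ hθ hθ1
  have hH := kyFan_isHermitian_laplacian (P := TorusSite 4 L × Fin 3)
    (linkHop (fundamentalRep (Fin 3)) U)
  set a : ℝ := 2 * t / θ with ha
  -- positivity of `Re D` and the floor subspace `W`
  obtain ⟨W, hWdim, hWfloor⟩ := kyFan_floor_subspace U a hH
  -- the right count is an eigenvalue count `M`
  set M := (Finset.univ.filter fun i => hH.eigenvalues i < a).card with hMdef
  have hM : Multiset.countP (fun z : ℂ => z.re < a) (∑ μ : Fin 4, ((2 : ℂ) •
      (1 : Matrix (TorusSite 4 L × Fin 3) (TorusSite 4 L × Fin 3) ℂ)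
        - linkHop (fundamentalRep (Fin 3)) U μ
        - (linkHop (fundamentalRep (Fin 3)) U μ)ᴴ)).charpoly.roots = M := by
    rw [hMdef, Summit.QuantumFields.QCD.Theorems.ExtinctionBuildsQCD.Negative.countP_roots_charpoly_eq_card
      hH (fun z : ℂ => z.re < a)]
    simp only [Complex.ofReal_re]
  rw [hM]
  -- `f = toEuclideanLin D` (kept opaque) and positivity of `Re D`
  obtain ⟨f, hfdef⟩ : ∃ f : Module.End ℂ (EuclideanSpace ℂ (QuarkIdx L)),
      f = toEuclideanLin (wilsonDirac (fundamentalRep (Fin 3)) U 0 1) := ⟨_, rfl⟩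
  have hchar : f.charpoly = (wilsonDirac (fundamentalRep (Fin 3)) U 0 1).charpoly := by
    rw [hfdef, show (toEuclideanLin : Matrix (QuarkIdx L) (QuarkIdx L) ℂ ≃ₗ[ℂ] _) =
      Matrix.toLin (PiLp.basisFun 2 ℂ (QuarkIdx L)) (PiLp.basisFun 2 ℂ (QuarkIdx L)) from
      Matrix.toLpLin_eq_toLin 2 2, Matrix.charpoly_toLin]
  have hpos : ∀ x : EuclideanSpace ℂ (QuarkIdx L), 0 ≤ (⟪x, f x⟫_ℂ).re := fun x => by
    rw [hfdef, kyFan_re_inner_toEuclideanLin,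
      TipNoBinding.PositivityNoLeakSpread.stub_positivity L U]
    positivity
  have hWfloor' : ∀ x ∈ W, a / 2 * ‖x‖ ^ 2 ≤ (⟪x, f x⟫_ℂ).re := fun x hx => by
    rw [hfdef]
    exact hWfloor x hx
  -- the spectral subspace `V` of `f` below `Re z < t` (sub-goal `stub_kyFanTraceCount`):
  -- `dim V = k`, `tr f|_V = Σ_{Re z < t} z`, and the trace floor on `V ∩ W`
  obtain ⟨V, hV, hk', htr', hVK⟩ :=
    stub_kyFanTraceCount (EuclideanSpace ℂ (QuarkIdx L)) f (fun z : ℂ => z.re < t)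
  set k := Multiset.countP (fun z : ℂ => z.re < t)
    (wilsonDirac (fundamentalRep (Fin 3)) U 0 1).charpoly.roots with hkdef
  have hk : Module.finrank ℂ V = k := by
    rw [hkdef, Multiset.countP_eq_card_filter, ← hchar]
    exact hk'
  have htr : LinearMap.trace ℂ V (f.restrict hV) =
      ((wilsonDirac (fundamentalRep (Fin 3)) U 0 1).charpoly.roots.filter
        fun z : ℂ => z.re < t).sum := by
    rw [← hchar]
    exact htr'
  obtain ⟨hdimVW, hlow⟩ := hVK W (a / 2) hpos hWfloor'
  have h0 : 0 ≤ (LinearMap.trace ℂ V (f.restrict hV)).re := by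
    have h := (hVK ⊥ 0 hpos fun x _ => by rw [zero_mul]; exact hpos x).2
    rwa [zero_mul] at h
  -- dimension count: `k ≤ dim (V ∩ W) + 4M`
  have hdim : k ≤ Module.finrank ℂ ↥(V ⊓ W) + 4 * M := by
    rw [finrank_euclideanSpace] at hdimVW
    omega
  -- the trace of `f|_V`, from above
  by_cases hk0 : k = 0
  · rw [hk0, Nat.cast_zero, mul_zero]
    positivity
  have hup : (LinearMap.trace ℂ V (f.restrict hV)).re < k * t := by
    rw [htr, hkdef, Multiset.countP_eq_card_filter]
    have hne : ((wilsonDirac (fundamentalRep (Fin 3)) U 0 1).charpoly.roots.filter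
        fun z : ℂ => z.re < t) ≠ ∅ := by
      intro h
      apply hk0
      rw [hkdef, Multiset.countP_eq_card_filter, h, Multiset.empty_eq_zero, Multiset.card_zero]
    have hlt := Multiset.sum_lt_sum_of_nonempty (f := Complex.re) (g := fun _ => t) hne
      (fun z hz => (Multiset.mem_filter.mp hz).2)
    rw [Multiset.map_const', Multiset.sum_replicate, nsmul_eq_mul] at hlt
    have hre : (((wilsonDirac (fundamentalRep (Fin 3)) U 0 1).charpoly.roots.filter
        fun z : ℂ => z.re < t).sum).re =
        (((wilsonDirac (fundamentalRep (Fin 3)) U 0 1).charpoly.roots.filter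
          fun z : ℂ => z.re < t).map Complex.re).sum := by
      simpa using map_multiset_sum Complex.reAddGroupHom
        ((wilsonDirac (fundamentalRep (Fin 3)) U 0 1).charpoly.roots.filter fun z : ℂ => z.re < t)
    rw [hre]
    exact hlt
  -- arithmetic
  have hkpos : (0 : ℝ) < k := by exact_mod_cast Nat.pos_of_ne_zero hk0
  have ht : 0 < t := pos_of_mul_pos_right (h0.trans_lt hup) hkpos.le
  have hK' : (Module.finrank ℂ ↥(V ⊓ W) : ℝ) < k * θ := by
    have h3 : a / 2 * (Module.finrank ℂ ↥(V ⊓ W) : ℝ) < k * t := hlow.trans_lt hup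
    rw [ha, show 2 * t / θ / 2 * (Module.finrank ℂ ↥(V ⊓ W) : ℝ) =
      t * (Module.finrank ℂ ↥(V ⊓ W) : ℝ) / θ by ring, div_lt_iff₀ hθ] at h3
    nlinarith
  have hdim' : (k : ℝ) ≤ (Module.finrank ℂ ↥(V ⊓ W) : ℝ) + 4 * (M : ℝ) := by exact_mod_cast hdim
  nlinarith

end

end Summit.QuantumFields.QCD.Cruxes.TipPricing.CovariantLaplacianFloor
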